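import Summits.BirchSwinnertonDyer.Rank1Residual.ManinAdditive.CMGammaOneRootLawInertThree
import Summits.BirchSwinnertonDyer.Rank1Residual.ManinAdditive.CMGammaOneRootLawBeyondQi
import Literature.NumberTheory.EllipticCurves.ModularCurveNeronLatticeProofs
import Literature.NumberTheory.EllipticCurves.IsogenyDualProofs
import Literature.NumberTheory.EllipticCurves.IsogenyCompProofs
import Literature.AlgebraicGeometry.PlaneCurves.HessePencilHarmonicMembers
import HarnessLib

/-!
# The `ℚ(i)` and `ℚ(√−3)` CM classes member by member WITHOUT twist-reduction data: the class-wise root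
# `Γ₁(N)`-laws at `2` and `3` from ANY CM member (cell `bsd-f2-manin`, planner `es` g32, MEMO-es §52; FILE A⁷ = this
# file; imports only LANDED files: `…CMGammaOneRootLawInertThree` (E-es-156/157, p732653), `…CMGammaOneRootLawBeyondQi`
# (E-es-154/155, p732179), four Literature proof files; independent of FILE A⁵/A⁶)

TYPER NOTE (typer g21, T-es-57).  SOURCE = HOME/es/g32/ClassTwoThree-es-g32.lean sha16 cc44cafc35f08f52 (352 l.; es: farm DIRECT rc 0 · 0 ·
0 · 0 at 17:28Z; typer: own farm check rc 0 · 0 warnings) VERBATIM except this note.  FILE A⁷ of es's CM series, ns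
`…ManinAdditive.KatoCurve.CMTwinMinimal` §12; THEOREM-ONLY (16 theorems, 0 defs, 0 conjecture nodes; kind auto → proof); imports only
LANDED modules (`…CMGammaOneRootLawInertThree` p732653, `…CMGammaOneRootLawBeyondQi` p732179, four Literature proof files) —
route-independent, independent of A⁵ (`…TwoLocalBeyond` p734908) / A⁶ (`CMClassSevenMembers`, T-es-56).  CONTENT (es MEMO-es §52): THEOREM
52₂/52₃ `exists_lattice_le_on_cmClass_two/three_of_classMembers` (every globally minimal member of a ℚ(i)- / ℚ(√−3)-CM class has
j = 1728 / 0 or contains the Néron lattice of such a member; inputs SHAPE₂⁺/SHAPE₃⁺ `CMClassMembersTwo/Three` (landed, REF1 §R173) +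
uniformisation `exists_isNeronLatticeOf_holds` + `IsIsogenous.symm_of_charZero`/`trans'` + the Vélu lattice lemmas), the class-wise root laws
`rootLawAtTwo/Three_on_cmClass_two/three` from ANY CM member (hypotheses: the landed nodes E-es-152₂ `CMGammaOneRootLawTwoLocal`, E-es-152₃
`CMGammaOneRootLawThreeLocal`, E-es-155 `CMGammaOneRootLawTwoLocalJ0`, E-es-156 `CMGammaOneRootLawThreeLocalJ1728` + Faltings
`LFunction_eq_of_isIsogenous`), COR 52.S ×4 (Stevens p ∤ c₁) and COR 52.R ×4 + the uniform `not_dvd_maninConstant_of_classLaw_of_twoTracelessPrimes`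
(C2/C3 p ∤ c₀ for lattice-optimal X₀-data with a second traceless prime), and the kernel cross-check `exists_twistParam_of_j_eq_neg3375`
(SHAPE₇⁺ (b): j = −3375 ⟹ (c₄, c₆) = (105u², 1323u³)).  No new conjecture node; nothing asserted beyond the named hypotheses.  es asked for
`--supports stmt-BirchSwinnertonDyer-22967`; the gate refuses `--supports` for `…/ManinAdditive/` targets (typer/README gotcha 108), so
bears_on is carried here: stmt-BirchSwinnertonDyer-22967 (C2) and stmt-BirchSwinnertonDyer-22968 (C3).  REFUTER: ref1 R-es-77 (SHAPE₇⁺ +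
by-name probe of these 16 theorems) PENDING at landing.  Typer checks: 17 decl names fresh tree-wide; no `[cite:]` keys; no instances, no
notation; 352 + note ≤ 400 lines.  PARTITION 0 · beyond-print theorem: no · BSD is not proved by this; C2/C3 OPEN.

THEOREM 46 / COR 46.S⁺ (landed `…CMTwinStevensMinimalMembers(Cor)`) transport the root laws of `ℚ(i)` / `ℚ(√−3)`
classes from a TWIST-REDUCED root `V` supplied by the consumer together with its Néron lattice `LV` and the
twist-reduction clause `hred`.  Following the `ℚ(√−7)` pattern of FILE A⁶ (THEOREM 51), this file removes that burden:
SHAPE₂⁺/SHAPE₃⁺ already NAME the Vélu root `W′` of each order member; its lattice comes from the uniformisation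
theorem (`exists_isNeronLatticeOf_holds`), `W′ ~ W` from `V ~ W′`, `V ~ W` by the PROVED symmetry/transitivity of
isogeny (`IsIsogenous.symm_of_charZero`, `IsIsogenous.trans'` = `trans_holds`), and Vélu (`lattice_le_of_velu_two_gaussian`,
`…_two_eisenstein`, `…_three_eisenstein`) gives `Λ(W′) ⊆ Λ(W)`.  Result (all kernel-checked, NO new conjecture node):
THEOREM 52₂/52₃ (every globally minimal member `W` of a `ℚ(i)`- resp. `ℚ(√−3)`-CM class has `j = 1728` resp. `0`, or
contains the Néron lattice of such a member of its class), the class-wise laws at `2` and `3` on both fields from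
E-es-152₂/152₃/155/156 with inputs «any member `V` with `c₆(V) = 0` resp. `c₄(V) = 0`, `V ~ W`» only, COR 52.S ×4
(Stevens `p ∤ c₁`, whichever member is `X₁(N)`-optimal) and COR 52.R ×4 (C2/C3 `p ∤ c₀` for `X₀(N)`-data with a second
traceless prime); plus the kernel cross-check of SHAPE₇⁺ (b): `j = −3375 ⟹ (c₄, c₆) = (105u², 1323u³)`.
PARTITION 0 · beyond-print theorem: no · bears_on stmt-BirchSwinnertonDyer-22967 (C2), stmt-BirchSwinnertonDyer-22968
(C3) · BSD is not proved by this.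
-/

set_option autoImplicit false

noncomputable section

namespace Summit.BirchSwinnertonDyer.Rank1Residual.ManinAdditive.KatoCurve.CMTwinMinimal

open Complex Polynomial WeierstrassCurve Literature.NumberTheory.EllipticCurves
  Literature.NumberTheory.EllipticCurves.ModularForms
  Summit.BirchSwinnertonDyer.Rank1Residual.ManinAdditive.KatoCurve.CMOptimal
  Summit.BirchSwinnertonDyer.Rank1Residual.ManinAdditive.KatoCurve.CMOptimal.TwinLattice

/-! ## §12 `ℚ(i)` and `ℚ(√−3)` classes from ANY member (MEMO-es §52) -/

section ClassTwoThree

open CongruenceSubgroup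
open scoped MatrixGroups ModularForm

variable {N : ℕ} [NeZero N]

/-- **THEOREM 52₂ (kernel) — every globally minimal member `W` of a `ℚ(i)`-CM class has `j = 1728` or CONTAINS the
Néron lattice of a `j = 1728` member of its class** (the Vélu root `[0,0,0,−d²,0]` named by SHAPE₂⁺; index `2`). -/
theorem exists_lattice_le_on_cmClass_two_of_classMembers (hcl : CMClassMembersTwo)
    (V W : WeierstrassCurve ℚ) [V.IsElliptic] [V.IsGloballyMinimal] [W.IsElliptic] [W.IsGloballyMinimal]
    (LW : PeriodPair) (hjV : V.j = 1728) (hiso : WeierstrassCurve.IsIsogenous V W)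
    (hLW : IsNeronLatticeOf (W.baseChange ℂ) LW) :
    W.j = 1728 ∨ ∃ (V' : WeierstrassCurve ℚ) (_ : V'.IsElliptic) (_ : V'.IsGloballyMinimal) (LV' : PeriodPair),
      V'.j = 1728 ∧ WeierstrassCurve.IsIsogenous V' W ∧ IsNeronLatticeOf (V'.baseChange ℂ) LV' ∧
        LV'.lattice ≤ LW.lattice := by
  rcases hcl V W hjV hiso with hjW | ⟨d, hd, hW4, hW6, W', hE', hmin', hjW', hiso', hW'4⟩
  · exact Or.inl hjW
  · haveI := hE'
    haveI := hmin'
    obtain ⟨LW', hLW'⟩ := exists_isNeronLatticeOf_holds (W'.baseChange ℂ)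
    have hisoW'W : WeierstrassCurve.IsIsogenous W' W :=
      IsIsogenous.trans' (IsIsogenous.symm_of_charZero hiso') hiso
    refine Or.inr ⟨W', hE', hmin', LW', hjW', hisoW'W, hLW', ?_⟩
    have hW'6 : W'.c₆ = 0 := (Literature.AlgebraicGeometry.PlaneCurves.j_eq_1728_iff_c₆_eq_zero W').mp hjW'
    obtain ⟨h2', h3'⟩ := hLW'
    obtain ⟨hW2, hW3⟩ := hLW
    rw [baseChange_c₄] at h2' hW2
    rw [baseChange_c₆] at h3' hW3
    rw [hW'4] at h2'
    rw [hW'6] at h3'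
    rw [hW4] at hW2
    rw [hW6] at hW3
    push_cast at h2' h3' hW2 hW3
    have hd0 : ((d : ℤ) : ℂ) ≠ 0 := by exact_mod_cast hd.ne_zero
    exact lattice_le_of_velu_two_gaussian LW' LW hd0 (by rw [h2']; ring) (by rw [h3']; ring)
      (by rw [hW2]; ring) (by rw [hW3]; ring)

/-- **THEOREM 52₃ (kernel) — every globally minimal member `W` of a `ℚ(√−3)`-CM class has `j = 0` or CONTAINS the
Néron lattice of a `j = 0` member of its class** (the Vélu roots `[0,0,0,0,c³]` (index `2`) resp. `c₆ = 216m³`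
(index `3`) named by SHAPE₃⁺). -/
theorem exists_lattice_le_on_cmClass_three_of_classMembers (hcl : CMClassMembersThree)
    (V W : WeierstrassCurve ℚ) [V.IsElliptic] [V.IsGloballyMinimal] [W.IsElliptic] [W.IsGloballyMinimal]
    (LW : PeriodPair) (hjV : V.j = 0) (hiso : WeierstrassCurve.IsIsogenous V W)
    (hLW : IsNeronLatticeOf (W.baseChange ℂ) LW) :
    W.j = 0 ∨ ∃ (V' : WeierstrassCurve ℚ) (_ : V'.IsElliptic) (_ : V'.IsGloballyMinimal) (LV' : PeriodPair),
      V'.j = 0 ∧ WeierstrassCurve.IsIsogenous V' W ∧ IsNeronLatticeOf (V'.baseChange ℂ) LV' ∧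
        LV'.lattice ≤ LW.lattice := by
  rcases hcl V W hjV hiso with hjW | ⟨c, hc, hW4, hW6, W', hE', hmin', hjW', hiso', hW'6⟩ |
    ⟨m, hm, hW4, hW6, W', hE', hmin', hjW', hiso', hW'6⟩
  · exact Or.inl hjW
  · haveI := hE'
    haveI := hmin'
    obtain ⟨LW', hLW'⟩ := exists_isNeronLatticeOf_holds (W'.baseChange ℂ)
    have hisoW'W : WeierstrassCurve.IsIsogenous W' W :=
      IsIsogenous.trans' (IsIsogenous.symm_of_charZero hiso') hiso
    refine Or.inr ⟨W', hE', hmin', LW', hjW', hisoW'W, hLW', ?_⟩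
    have hW'4 : W'.c₄ = 0 := (WeierstrassCurve.j_eq_zero_iff (W := W')).mp hjW'
    obtain ⟨h2', h3'⟩ := hLW'
    obtain ⟨hW2, hW3⟩ := hLW
    rw [baseChange_c₄] at h2' hW2
    rw [baseChange_c₆] at h3' hW3
    rw [hW'4] at h2'
    rw [hW'6] at h3'
    rw [hW4] at hW2
    rw [hW6] at hW3
    push_cast at h2' h3' hW2 hW3
    have hc0 : ((c : ℚ) : ℂ) ≠ 0 := by exact_mod_cast hc
    exact lattice_le_of_velu_two_eisenstein LW' LW hc0 (by rw [h2']; ring) (by rw [h3']; ring)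
      (by rw [hW2]; ring) (by rw [hW3]; ring)
  · haveI := hE'
    haveI := hmin'
    obtain ⟨LW', hLW'⟩ := exists_isNeronLatticeOf_holds (W'.baseChange ℂ)
    have hisoW'W : WeierstrassCurve.IsIsogenous W' W :=
      IsIsogenous.trans' (IsIsogenous.symm_of_charZero hiso') hiso
    refine Or.inr ⟨W', hE', hmin', LW', hjW', hisoW'W, hLW', ?_⟩
    have hW'4 : W'.c₄ = 0 := (WeierstrassCurve.j_eq_zero_iff (W := W')).mp hjW'
    obtain ⟨h2', h3'⟩ := hLW'
    obtain ⟨hW2, hW3⟩ := hLW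
    rw [baseChange_c₄] at h2' hW2
    rw [baseChange_c₆] at h3' hW3
    rw [hW'4] at h2'
    rw [hW'6] at h3'
    rw [hW4] at hW2
    rw [hW6] at hW3
    push_cast at h2' h3' hW2 hW3
    exact lattice_le_of_velu_three_eisenstein LW' LW (m := ((m : ℚ) : ℂ)) (by rw [h2', zero_div]) (by rw [h3']; ring)
      (by rw [hW2]; ring) (by rw [hW3]; ring)

/-- **Class-wise root law at `2` on `ℚ(i)` classes from ANY member** (E-es-152₂ at the Vélu root + THM 52₂ + Faltings):
for every globally minimal `W` isogenous to a `V` with `c₆(V) = 0`, `Λ₁(f) ⊆ Λ(W) ⊗ ℤ₍₂₎` (no level hypothesis). -/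
theorem rootLawAtTwo_on_cmClass_two (h152 : CMGammaOneRootLawTwoLocal) (hcl : CMClassMembersTwo)
    (hL : LFunction_eq_of_isIsogenous)
    (W : WeierstrassCurve ℚ) [W.IsElliptic] [W.IsGloballyMinimal] (f : CuspForm (Gamma0 N) 2) (LW : PeriodPair)
    (hfW : IsNewformOf W f) (hLW : IsNeronLatticeOf (W.baseChange ℂ) LW)
    (V : WeierstrassCurve ℚ) [V.IsElliptic] [V.IsGloballyMinimal] (h6 : V.c₆ = 0)
    (hiso : WeierstrassCurve.IsIsogenous V W) :
    ∀ z ∈ periodLatticeGamma1 f, ∃ s : ℤ, ¬ (2 : ℤ) ∣ s ∧ (s : ℂ) * z ∈ LW.lattice := by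
  intro z hz
  have hjV : V.j = 1728 := (Literature.AlgebraicGeometry.PlaneCurves.j_eq_1728_iff_c₆_eq_zero V).mpr h6
  rcases exists_lattice_le_on_cmClass_two_of_classMembers hcl V W LW hjV hiso hLW with
    hjW | ⟨V', hE', hmin', LV', hjV', hiso', hLV', hle⟩
  · exact h152 W f LW ((Literature.AlgebraicGeometry.PlaneCurves.j_eq_1728_iff_c₆_eq_zero W).mp hjW) hfW hLW z hz
  · haveI := hE'
    haveI := hmin'
    have hfV' : IsNewformOf V' f := isNewformOf_of_isIsogenous hL hfW hiso'
    obtain ⟨s, hs, hsz⟩ := h152 V' f LV'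
      ((Literature.AlgebraicGeometry.PlaneCurves.j_eq_1728_iff_c₆_eq_zero V').mp hjV') hfV' hLV' z hz
    exact ⟨s, hs, hle hsz⟩

/-- **Class-wise root law at `3` on `ℚ(i)` classes with `9 ∣ N` from ANY member** (E-es-156 + THM 52₂ + Faltings). -/
theorem rootLawAtThree_on_cmClass_two (h156 : CMGammaOneRootLawThreeLocalJ1728) (hcl : CMClassMembersTwo)
    (hL : LFunction_eq_of_isIsogenous)
    (W : WeierstrassCurve ℚ) [W.IsElliptic] [W.IsGloballyMinimal] (f : CuspForm (Gamma0 N) 2) (LW : PeriodPair)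
    (hfW : IsNewformOf W f) (hLW : IsNeronLatticeOf (W.baseChange ℂ) LW)
    (V : WeierstrassCurve ℚ) [V.IsElliptic] [V.IsGloballyMinimal] (h6 : V.c₆ = 0)
    (hiso : WeierstrassCurve.IsIsogenous V W) (hN : 3 ^ 2 ∣ N) :
    ∀ z ∈ periodLatticeGamma1 f, ∃ s : ℤ, ¬ (3 : ℤ) ∣ s ∧ (s : ℂ) * z ∈ LW.lattice := by
  intro z hz
  have hjV : V.j = 1728 := (Literature.AlgebraicGeometry.PlaneCurves.j_eq_1728_iff_c₆_eq_zero V).mpr h6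
  rcases exists_lattice_le_on_cmClass_two_of_classMembers hcl V W LW hjV hiso hLW with
    hjW | ⟨V', hE', hmin', LV', hjV', hiso', hLV', hle⟩
  · exact h156 W f LW ((Literature.AlgebraicGeometry.PlaneCurves.j_eq_1728_iff_c₆_eq_zero W).mp hjW) hN hfW
      hLW z hz
  · haveI := hE'
    haveI := hmin'
    have hfV' : IsNewformOf V' f := isNewformOf_of_isIsogenous hL hfW hiso'
    obtain ⟨s, hs, hsz⟩ := h156 V' f LV'
      ((Literature.AlgebraicGeometry.PlaneCurves.j_eq_1728_iff_c₆_eq_zero V').mp hjV') hN hfV' hLV' z hz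
    exact ⟨s, hs, hle hsz⟩

/-- **Class-wise root law at `3` on `ℚ(√−3)` classes from ANY member** (E-es-152₃ at the Vélu roots + THM 52₃ +
Faltings): for every globally minimal `W` isogenous to a `V` with `c₄(V) = 0`, `Λ₁(f) ⊆ Λ(W) ⊗ ℤ₍₃₎`. -/
theorem rootLawAtThree_on_cmClass_three (h152 : CMGammaOneRootLawThreeLocal) (hcl : CMClassMembersThree)
    (hL : LFunction_eq_of_isIsogenous)
    (W : WeierstrassCurve ℚ) [W.IsElliptic] [W.IsGloballyMinimal] (f : CuspForm (Gamma0 N) 2) (LW : PeriodPair)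
    (hfW : IsNewformOf W f) (hLW : IsNeronLatticeOf (W.baseChange ℂ) LW)
    (V : WeierstrassCurve ℚ) [V.IsElliptic] [V.IsGloballyMinimal] (h4 : V.c₄ = 0)
    (hiso : WeierstrassCurve.IsIsogenous V W) :
    ∀ z ∈ periodLatticeGamma1 f, ∃ s : ℤ, ¬ (3 : ℤ) ∣ s ∧ (s : ℂ) * z ∈ LW.lattice := by
  intro z hz
  have hjV : V.j = 0 := (WeierstrassCurve.j_eq_zero_iff (W := V)).mpr h4
  rcases exists_lattice_le_on_cmClass_three_of_classMembers hcl V W LW hjV hiso hLW with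
    hjW | ⟨V', hE', hmin', LV', hjV', hiso', hLV', hle⟩
  · exact h152 W f LW ((WeierstrassCurve.j_eq_zero_iff (W := W)).mp hjW) hfW hLW z hz
  · haveI := hE'
    haveI := hmin'
    have hfV' : IsNewformOf V' f := isNewformOf_of_isIsogenous hL hfW hiso'
    obtain ⟨s, hs, hsz⟩ := h152 V' f LV' ((WeierstrassCurve.j_eq_zero_iff (W := V')).mp hjV') hfV' hLV' z hz
    exact ⟨s, hs, hle hsz⟩

/-- **Class-wise root law at `2` on `ℚ(√−3)` classes with `4 ∣ N` from ANY member** (E-es-155 + THM 52₃ + Faltings). -/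
theorem rootLawAtTwo_on_cmClass_three (h155 : CMGammaOneRootLawTwoLocalJ0) (hcl : CMClassMembersThree)
    (hL : LFunction_eq_of_isIsogenous)
    (W : WeierstrassCurve ℚ) [W.IsElliptic] [W.IsGloballyMinimal] (f : CuspForm (Gamma0 N) 2) (LW : PeriodPair)
    (hfW : IsNewformOf W f) (hLW : IsNeronLatticeOf (W.baseChange ℂ) LW)
    (V : WeierstrassCurve ℚ) [V.IsElliptic] [V.IsGloballyMinimal] (h4 : V.c₄ = 0)
    (hiso : WeierstrassCurve.IsIsogenous V W) (hN : 2 ^ 2 ∣ N) :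
    ∀ z ∈ periodLatticeGamma1 f, ∃ s : ℤ, ¬ (2 : ℤ) ∣ s ∧ (s : ℂ) * z ∈ LW.lattice := by
  intro z hz
  have hjV : V.j = 0 := (WeierstrassCurve.j_eq_zero_iff (W := V)).mpr h4
  rcases exists_lattice_le_on_cmClass_three_of_classMembers hcl V W LW hjV hiso hLW with
    hjW | ⟨V', hE', hmin', LV', hjV', hiso', hLV', hle⟩
  · exact h155 W f LW ((WeierstrassCurve.j_eq_zero_iff (W := W)).mp hjW) hN hfW hLW z hz
  · haveI := hE'
    haveI := hmin'
    have hfV' : IsNewformOf V' f := isNewformOf_of_isIsogenous hL hfW hiso'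
    obtain ⟨s, hs, hsz⟩ := h155 V' f LV' ((WeierstrassCurve.j_eq_zero_iff (W := V')).mp hjV') hN hfV' hLV' z hz
    exact ⟨s, hs, hle hsz⟩

/-- **COR 52.S₂(i)** — Stevens' `2 ∤ c₁` for the `X₁(N)`-optimal curve of EVERY `ℚ(i)`-CM class, whichever member is
optimal, from any member `V` with `c₆(V) = 0` (no `hred`, no `LV`, no level hypothesis). -/
theorem not_two_dvd_maninConstant₁_on_cmClass_two_any (h152 : CMGammaOneRootLawTwoLocal)
    (hcl : CMClassMembersTwo) (hL : LFunction_eq_of_isIsogenous)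
    (W : WeierstrassCurve ℚ) [W.IsElliptic] [W.IsGloballyMinimal] (D : Gamma1ParametrizationData W N)
    (hopt : D.IsOptimal) (V : WeierstrassCurve ℚ) [V.IsElliptic] [V.IsGloballyMinimal] (h6 : V.c₆ = 0)
    (hiso : WeierstrassCurve.IsIsogenous V W) : ¬ (2 : ℤ) ∣ D.maninConstant :=
  not_dvd_maninConstant₁_of_rootLaw_of_witness D hopt
    (rootLawAtTwo_on_cmClass_two h152 hcl hL W D.f D.L D.isNewformOf D.isNeronLattice V h6 hiso)
    (exists_primitive_witness D.L 2)

/-- **COR 52.S₃(i)** — Stevens' `3 ∤ c₁` on every `ℚ(i)`-CM class with `9 ∣ N`, from any member with `c₆ = 0`. -/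
theorem not_three_dvd_maninConstant₁_on_cmClass_two_any (h156 : CMGammaOneRootLawThreeLocalJ1728)
    (hcl : CMClassMembersTwo) (hL : LFunction_eq_of_isIsogenous)
    (W : WeierstrassCurve ℚ) [W.IsElliptic] [W.IsGloballyMinimal] (D : Gamma1ParametrizationData W N)
    (hopt : D.IsOptimal) (V : WeierstrassCurve ℚ) [V.IsElliptic] [V.IsGloballyMinimal] (h6 : V.c₆ = 0)
    (hiso : WeierstrassCurve.IsIsogenous V W) (hN : 3 ^ 2 ∣ N) : ¬ (3 : ℤ) ∣ D.maninConstant :=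
  not_dvd_maninConstant₁_of_rootLaw_of_witness D hopt
    (rootLawAtThree_on_cmClass_two h156 hcl hL W D.f D.L D.isNewformOf D.isNeronLattice V h6 hiso hN)
    (exists_primitive_witness D.L 3)

/-- **COR 52.S₃(√−3)** — Stevens' `3 ∤ c₁` on every `ℚ(√−3)`-CM class, from any member with `c₄ = 0`. -/
theorem not_three_dvd_maninConstant₁_on_cmClass_three_any (h152 : CMGammaOneRootLawThreeLocal)
    (hcl : CMClassMembersThree) (hL : LFunction_eq_of_isIsogenous)
    (W : WeierstrassCurve ℚ) [W.IsElliptic] [W.IsGloballyMinimal] (D : Gamma1ParametrizationData W N)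
    (hopt : D.IsOptimal) (V : WeierstrassCurve ℚ) [V.IsElliptic] [V.IsGloballyMinimal] (h4 : V.c₄ = 0)
    (hiso : WeierstrassCurve.IsIsogenous V W) : ¬ (3 : ℤ) ∣ D.maninConstant :=
  not_dvd_maninConstant₁_of_rootLaw_of_witness D hopt
    (rootLawAtThree_on_cmClass_three h152 hcl hL W D.f D.L D.isNewformOf D.isNeronLattice V h4 hiso)
    (exists_primitive_witness D.L 3)

/-- **COR 52.S₂(√−3)** — Stevens' `2 ∤ c₁` on every `ℚ(√−3)`-CM class with `4 ∣ N`, from any member with `c₄ = 0`. -/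
theorem not_two_dvd_maninConstant₁_on_cmClass_three_any (h155 : CMGammaOneRootLawTwoLocalJ0)
    (hcl : CMClassMembersThree) (hL : LFunction_eq_of_isIsogenous)
    (W : WeierstrassCurve ℚ) [W.IsElliptic] [W.IsGloballyMinimal] (D : Gamma1ParametrizationData W N)
    (hopt : D.IsOptimal) (V : WeierstrassCurve ℚ) [V.IsElliptic] [V.IsGloballyMinimal] (h4 : V.c₄ = 0)
    (hiso : WeierstrassCurve.IsIsogenous V W) (hN : 2 ^ 2 ∣ N) : ¬ (2 : ℤ) ∣ D.maninConstant :=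
  not_dvd_maninConstant₁_of_rootLaw_of_witness D hopt
    (rootLawAtTwo_on_cmClass_three h155 hcl hL W D.f D.L D.isNewformOf D.isNeronLattice V h4 hiso hN)
    (exists_primitive_witness D.L 2)

/-- **COR 52.R — C2/C3 for `X₀(N)`-data on EVERY member of a `ℚ(i)`/`ℚ(√−3)`-CM class from ANY member**, given the
class-wise law at `p` (any of the four theorems above, as the hypothesis `hlaw`) and a second traceless prime `q ≠ p`
with `p² ∣ N`, `q² ∣ N` (`Λ₁(f) = Λ₀(f)` by `gamma1LatticeEqOfTwoTracelessPrimes`).  One statement for all four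
cases: `p` prime, `hlaw : ∀ z ∈ Λ₁(D.f), ∃ s, p ∤ s ∧ s·z ∈ Λ(W)`. -/
theorem not_dvd_maninConstant_of_classLaw_of_twoTracelessPrimes
    (W : WeierstrassCurve ℚ) [W.IsElliptic] [W.IsGloballyMinimal] (D : ModularParametrizationData W N)
    (hD : ∀ z ∈ D.L.lattice, ∃ w ∈ periodLattice D.f, z = D.c * w)
    {p q : ℕ} (hp : p.Prime) (hq : q.Prime) (hpq : q ≠ p) (hpN : p ^ 2 ∣ N) (hqN : q ^ 2 ∣ N)
    (hlaw : ∀ z ∈ periodLatticeGamma1 D.f, ∃ s : ℤ, ¬ (p : ℤ) ∣ s ∧ (s : ℂ) * z ∈ D.L.lattice) :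
    ¬ (p : ℤ) ∣ D.maninConstant := by
  have hfW : IsNewformOf W D.f := D.isNewformOf
  have heq := ModularForms.gamma1LatticeEqOfTwoTracelessPrimes_holds N D.f hfW.1 p q hp hq
    (Ne.symm hpq) ((dvd_pow_self p two_ne_zero).trans hpN) ((dvd_pow_self q two_ne_zero).trans hqN)
    (hfW.1.cuspCoeff_eq_zero_of_sq_dvd hp hpN) (hfW.1.cuspCoeff_eq_zero_of_sq_dvd hq hqN)
  obtain ⟨z, hz, hzM⟩ := exists_primitive_witness D.L (p : ℤ)
  refine not_dvd_maninConstant_of_saturated_mem_of_witness D hD (Nat.prime_iff_prime_int.mp hp) D.L.lattice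
    (fun γ => hlaw _ ?_) ⟨z, hz, fun s hs m hm => ?_⟩
  · rw [heq]; unfold periodLattice; exact AddSubgroup.subset_closure ⟨γ, rfl⟩
  · exact_mod_cast hzM s hs m hm

/-- **COR 52.R₂(i)** — C2 (`2 ∤ c₀`) for `X₀(N)`-data on every member of a `ℚ(i)`-CM class with `4 ∣ N` and a second
traceless prime `q` (`q² ∣ N`), from any member with `c₆ = 0`. -/
theorem not_two_dvd_maninConstant_on_cmClass_two_any (h152 : CMGammaOneRootLawTwoLocal)
    (hcl : CMClassMembersTwo) (hL : LFunction_eq_of_isIsogenous)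
    (W : WeierstrassCurve ℚ) [W.IsElliptic] [W.IsGloballyMinimal] (D : ModularParametrizationData W N)
    (hD : ∀ z ∈ D.L.lattice, ∃ w ∈ periodLattice D.f, z = D.c * w)
    (V : WeierstrassCurve ℚ) [V.IsElliptic] [V.IsGloballyMinimal] (h6 : V.c₆ = 0)
    (hiso : WeierstrassCurve.IsIsogenous V W)
    {q : ℕ} (hq : q.Prime) (hq2 : q ≠ 2) (h4 : 2 ^ 2 ∣ N) (hqN : q ^ 2 ∣ N) :
    ¬ (2 : ℤ) ∣ D.maninConstant :=
  not_dvd_maninConstant_of_classLaw_of_twoTracelessPrimes W D hD Nat.prime_two hq hq2 h4 hqN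
    (rootLawAtTwo_on_cmClass_two h152 hcl hL W D.f D.L D.isNewformOf D.isNeronLattice V h6 hiso)

/-- **COR 52.R₃(√−3)** — C3 (`3 ∤ c₀`) for `X₀(N)`-data on every member of a `ℚ(√−3)`-CM class with `9 ∣ N` and a
second traceless prime, from any member with `c₄ = 0`. -/
theorem not_three_dvd_maninConstant_on_cmClass_three_any (h152 : CMGammaOneRootLawThreeLocal)
    (hcl : CMClassMembersThree) (hL : LFunction_eq_of_isIsogenous)
    (W : WeierstrassCurve ℚ) [W.IsElliptic] [W.IsGloballyMinimal] (D : ModularParametrizationData W N)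
    (hD : ∀ z ∈ D.L.lattice, ∃ w ∈ periodLattice D.f, z = D.c * w)
    (V : WeierstrassCurve ℚ) [V.IsElliptic] [V.IsGloballyMinimal] (h4 : V.c₄ = 0)
    (hiso : WeierstrassCurve.IsIsogenous V W)
    {q : ℕ} (hq : q.Prime) (hq3 : q ≠ 3) (h9 : 3 ^ 2 ∣ N) (hqN : q ^ 2 ∣ N) :
    ¬ (3 : ℤ) ∣ D.maninConstant :=
  not_dvd_maninConstant_of_classLaw_of_twoTracelessPrimes W D hD Nat.prime_three hq hq3 h9 hqN
    (rootLawAtThree_on_cmClass_three h152 hcl hL W D.f D.L D.isNewformOf D.isNeronLattice V h4 hiso)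

/-- **COR 52.R₃(i)** — C3 for `X₀(N)`-data on every member of a `ℚ(i)`-CM class with `9 ∣ N` (`q = 2` always
available: `ℚ(i)`-CM curves have `2⁵ ∣ N`). -/
theorem not_three_dvd_maninConstant_on_cmClass_two_any (h156 : CMGammaOneRootLawThreeLocalJ1728)
    (hcl : CMClassMembersTwo) (hL : LFunction_eq_of_isIsogenous)
    (W : WeierstrassCurve ℚ) [W.IsElliptic] [W.IsGloballyMinimal] (D : ModularParametrizationData W N)
    (hD : ∀ z ∈ D.L.lattice, ∃ w ∈ periodLattice D.f, z = D.c * w)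
    (V : WeierstrassCurve ℚ) [V.IsElliptic] [V.IsGloballyMinimal] (h6 : V.c₆ = 0)
    (hiso : WeierstrassCurve.IsIsogenous V W)
    {q : ℕ} (hq : q.Prime) (hq3 : q ≠ 3) (h9 : 3 ^ 2 ∣ N) (hqN : q ^ 2 ∣ N) :
    ¬ (3 : ℤ) ∣ D.maninConstant :=
  not_dvd_maninConstant_of_classLaw_of_twoTracelessPrimes W D hD Nat.prime_three hq hq3 h9 hqN
    (rootLawAtThree_on_cmClass_two h156 hcl hL W D.f D.L D.isNewformOf D.isNeronLattice V h6 hiso h9)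

/-- **COR 52.R₂(√−3)** — C2 for `X₀(N)`-data on every member of a `ℚ(√−3)`-CM class with `4 ∣ N` (`q = 3` always
available: `27 ∣ N`). -/
theorem not_two_dvd_maninConstant_on_cmClass_three_any (h155 : CMGammaOneRootLawTwoLocalJ0)
    (hcl : CMClassMembersThree) (hL : LFunction_eq_of_isIsogenous)
    (W : WeierstrassCurve ℚ) [W.IsElliptic] [W.IsGloballyMinimal] (D : ModularParametrizationData W N)
    (hD : ∀ z ∈ D.L.lattice, ∃ w ∈ periodLattice D.f, z = D.c * w)
    (V : WeierstrassCurve ℚ) [V.IsElliptic] [V.IsGloballyMinimal] (h4 : V.c₄ = 0)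
    (hiso : WeierstrassCurve.IsIsogenous V W)
    {q : ℕ} (hq : q.Prime) (hq2 : q ≠ 2) (h4N : 2 ^ 2 ∣ N) (hqN : q ^ 2 ∣ N) :
    ¬ (2 : ℤ) ∣ D.maninConstant :=
  not_dvd_maninConstant_of_classLaw_of_twoTracelessPrimes W D hD Nat.prime_two hq hq2 h4N hqN
    (rootLawAtTwo_on_cmClass_three h155 hcl hL W D.f D.L D.isNewformOf D.isNeronLattice V h4 hiso h4N)

/-- **Kernel cross-check of SHAPE₇⁺ (b): every `j = −3375` elliptic curve over `ℚ` is `(c₄, c₆) = (105u², 1323u³)`**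
(`c₄³ = jΔ = −3375Δ`, `c₆² = (j − 1728)Δ = −5103Δ`, `5103·105³ = 3375·1323²`; `u = 105c₆/(1323c₄)`). -/
theorem exists_twistParam_of_j_eq_neg3375 (V : WeierstrassCurve ℚ) [V.IsElliptic] (hj : V.j = -3375) :
    ∃ u : ℚ, u ≠ 0 ∧ V.c₄ = 105 * u ^ 2 ∧ V.c₆ = 1323 * u ^ 3 := by
  have hΔ : V.Δ ≠ 0 := by rw [← WeierstrassCurve.coe_Δ']; exact V.Δ'.ne_zero
  have key := Literature.AlgebraicGeometry.PlaneCurves.j_sub_1728_mul_Δ V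
  have hc := V.c_relation
  rw [hj] at key
  have h6 : V.c₆ ^ 2 = -5103 * V.Δ := by linear_combination -key
  have h4 : V.c₄ ^ 3 = -3375 * V.Δ := by linear_combination -key - hc
  have hc4 : V.c₄ ≠ 0 := by
    intro h0; rw [h0] at h4; apply hΔ; linear_combination (1 / 3375 : ℚ) * h4
  have hc6 : V.c₆ ≠ 0 := by
    intro h0; rw [h0] at h6; apply hΔ; linear_combination (1 / 5103 : ℚ) * h6
  refine ⟨105 * V.c₆ / (1323 * V.c₄), ?_, ?_, ?_⟩
  · exact div_ne_zero (mul_ne_zero (by norm_num) hc6) (mul_ne_zero (by norm_num) hc4)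
  · rw [div_pow, mul_pow, eq_comm, mul_div_assoc', div_eq_iff (by positivity)]
    linear_combination (105 ^ 3 : ℚ) * h6 - (1323 ^ 2 : ℚ) * h4
  · rw [div_pow, mul_pow, eq_comm, mul_div_assoc', div_eq_iff (by positivity)]
    linear_combination (1323 * 105 ^ 3 * V.c₆ : ℚ) * h6 - (1323 ^ 3 * V.c₆ : ℚ) * h4

end ClassTwoThree

end Summit.BirchSwinnertonDyer.Rank1Residual.ManinAdditive.KatoCurve.CMTwinMinimal

end
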